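import Summits.QuantumFields.QCD.Theses.SpectralDefectExtinction
import Literature.MathematicalPhysics.QuantumFieldTheory.QCDPhaseQuenched
import Literature.MathematicalPhysics.QuantumFieldTheory.SpectralDefectDensity
import Literature.Barriers.QuantumFields.WilsonDeterminantMassSplitting
import Summits.QuantumFields.QCD.Theorems.SpectralDefectExtinctionWegnerEstimateSketchDefs
import Summits.QuantumFields.QCD.Theorems.SpectralDefectExtinctionWegnerEstimateStubDiracLocality
import Summits.QuantumFields.QCD.Theorems.SpectralDefectExtinctionWegnerEstimateCoareaHellmannFeynman

/-!
# Bridge toward the rigidity stubs of line `Sketch` (skeleton "ResolventCell", gen 2b/2c) for crux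
`SpectralDefectExtinction.WegnerEstimate` (item stmt-QuantumFields-8966): sampling identities on `ℤ⁴`

The min-functionals of the current-rigidity reduction (`badR`, `badPort` of the landed
`SpectralDefectExtinctionWegnerEstimateSketchDefs`) are built from the `ℤ⁴` formulas `latticeApply` /
`latticeCurrent` (and their ball-field instances `ballApply` / `ballCurrent`) applied to a zero-extended field
`v : ℤ⁴ → Fin 3 → Fin 4 → ℂ` and to link data read around a site `x` of the torus, `w = fun l => W (x + proj l.1, l.2)`.
This file certifies that these formulas ARE the torus objects sampled at `x + proj y` (companion file
`…BallSamplingPullback`: the instances for the pulled-back ball and port fields):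

* `ballSampling_mulVec_apply` — the ROW FORMULA of the Hermitian Wilson–Dirac matrix
  `H(W) = Γ₅ D_W(W, m₀, 1)` (`spinorLift gammaFive * wilsonDirac (fundamentalRep (Fin 3)) W m₀ 1`) on ANY torus
  `L ≥ 1`: `(H ψ)(z, a, α) = (m₀ + 4) Σ_γ (γ₅)_{αγ} ψ(z, a, γ) + Σ_μ Σ_{b β} [fwdHop μ α β · W(z, μ)_{ab} ·
  ψ(z + μ̂, b, β) + bwdHop μ α β · (W(z − μ̂, μ)⁻¹)_{ab} · ψ(z − μ̂, b, β)]` (the backward neighbour `q`,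
  `z = q + μ̂`, is unique on `(ZMod L)⁴`; for `L ≤ 2` it may coincide with `z + μ̂` and the two hops are still two
  summands, exactly as in `wilsonDirac`);
* `ballSampling_latticeApply_eq` / `_sub` (formula level) and `ballSampling_latticeApply_read_eq` / `_read_sub`
  (over the landed `latticeApply`) — the SAMPLING IDENTITY: for a zero-extended field `v` agreeing with the
  pull-back `y ↦ ψ(x + proj y)` at `y` and at the eight neighbours `y ± μ̂`,
  `latticeApply m₀ w v y a α = (H ψ)(x + proj y, a, α)`; in general the difference is `latticeApply` of the defect
  `v − ψ(x + proj ·)` (linearity), which prices a cut-off neighbour (faces of a cube);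
* `ballSampling_latticeCurrent_eq`, `ballSampling_latticeCurrent_read_eq`, `ballSampling_current_verbatim` — the
  CURRENT IDENTITY: `latticeCurrent w v y μ i` is the `(y, μ, i)` summand of the registered right-hand side of
  `stub_currentRigidity` when `v` is the pull-back at `y` and `y + μ̂`, and `0` when `v` is cut off at either end
  (`ballSampling_latticeCurrent_eq_zero(_of_base)`); hence for a CUT-OFF PULL-BACK (at every site either the
  pull-back or `0` — e.g. `ballVal`, `portVal` of a restriction of `ψ`) `|latticeCurrent| ≤ |J|` link by link
  (`ballSampling_abs_latticeCurrent(_read)_le`) and the cube current sum is at most the registered right-hand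
  side VERBATIM, glue included (`ballSampling_cubeCurrent_le_verbatim`).

The companion file adds the local-mass inequality `boxMass ψ (image of S) ≤ Σ_{y ∈ S} ‖ψ(x + proj y)‖²` (sum over
PREIMAGES, no injectivity) and the instances for the pulled-back ball / port fields.

All statements are over the landed definitions; no new definitions.  Torus bookkeeping from the landed
`…StubDiracLocality` (`diracLocality_proj_add/sub/single`) and the fibre-sum lemma `coareaWegner_sum_ite_fst_eq`
of `…CoareaHellmannFeynman` are reused.
-/

noncomputable section

namespace Summit.QuantumFields.QCD.Cruxes.WegnerEstimate.ResolventCell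

open scoped Matrix BigOperators
open Literature.MathematicalPhysics.QuantumLattice Literature.MathematicalPhysics.QuantumFieldTheory
  Literature.Probability.LatticeModels
open Matrix

/-! ### Spin algebra: `γ₅` rows and the hop blocks entrywise -/

/-- A row of `γ₅ = diag(1, 1, -1, -1)` against a vector: `Σ_γ (γ₅)_{αγ} f γ = ε_α f α`. -/
theorem ballSampling_gammaFive_row_sum (α : Fin 4) (f : Fin 4 → ℂ) :
    ∑ γ : Fin 4, gammaFive α γ * f γ = (![1, 1, -1, -1] : Fin 4 → ℂ) α * f α := by
  rw [gammaFive_eq_diagonal]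
  simp only [diagonal_apply, ite_mul, zero_mul, Finset.sum_ite_eq, Finset.mem_univ, if_true]

/-- Entries of the forward hop block: `(Γ₅ · (−½)(1 − γ_μ))_{αβ} = ε_α · (−½)(1 − γ_μ)_{αβ}`. -/
theorem ballSampling_fwdHop_apply (μ α β : Fin 4) :
    fwdHop μ α β = (![1, 1, -1, -1] : Fin 4 → ℂ) α *
      (-(1 / 2 : ℂ) * ((1 : Matrix (Fin 4) (Fin 4) ℂ) - euclideanGamma μ) α β) := by
  rw [fwdHop, gammaFive_eq_diagonal, diagonal_mul, Matrix.smul_apply, smul_eq_mul]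

/-- Entries of the backward hop block: `(Γ₅ · (−½)(1 + γ_μ))_{αβ} = ε_α · (−½)(1 + γ_μ)_{αβ}`. -/
theorem ballSampling_bwdHop_apply (μ α β : Fin 4) :
    bwdHop μ α β = (![1, 1, -1, -1] : Fin 4 → ℂ) α *
      (-(1 / 2 : ℂ) * ((1 : Matrix (Fin 4) (Fin 4) ℂ) + euclideanGamma μ) α β) := by
  rw [bwdHop, gammaFive_eq_diagonal, diagonal_mul, Matrix.smul_apply, smul_eq_mul]

/-! ### Torus bookkeeping -/

/-- On the torus `(ZMod L)⁴` (any `L`), `z = t + μ̂ ↔ t = z − μ̂`: the backward neighbour is unique. -/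
theorem ballSampling_eq_shift_iff {L : ℕ} (z t : TorusSite 4 L) (μ : Fin 4) :
    z = Literature.MathematicalPhysics.QuantumFieldTheory.Site.shift t μ ↔ t = z - Pi.single μ 1 := by
  constructor
  · rintro rfl
    rw [Literature.MathematicalPhysics.QuantumFieldTheory.Site.shift, add_sub_cancel_right]
  · rintro rfl
    rw [Literature.MathematicalPhysics.QuantumFieldTheory.Site.shift, sub_add_cancel]

/-- `x + proj (y + μ̂) = (x + proj y) + μ̂` (`proj` is additive and fixes the unit vectors). -/
theorem ballSampling_proj_add_single (L : ℕ) (x : TorusSite 4 L) (y : Fin 4 → ℤ) (μ : Fin 4) :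
    x + Torus.proj L (y + Pi.single μ 1) =
      Literature.MathematicalPhysics.QuantumFieldTheory.Site.shift (x + Torus.proj L y) μ := by
  rw [diracLocality_proj_add, diracLocality_proj_single,
    Literature.MathematicalPhysics.QuantumFieldTheory.Site.shift, add_assoc]

/-- `x + proj (y − μ̂) = (x + proj y) − μ̂`. -/
theorem ballSampling_proj_sub_single (L : ℕ) (x : TorusSite 4 L) (y : Fin 4 → ℤ) (μ : Fin 4) :
    x + Torus.proj L (y - Pi.single μ 1) = x + Torus.proj L y - Pi.single μ 1 := by
  rw [diracLocality_proj_sub, diracLocality_proj_single, add_sub_assoc]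

/-! ### The row formula of `Γ₅ D_W` on the torus -/

/-- Algebraic skeleton of the row computation `Σ_q (d_q − c Σ_μ (A_μq + B_μq)) ψ_q`. -/
theorem ballSampling_sum_aux {X ι : Type*} [Fintype X] [Fintype ι] (c : ℂ) (d ψ : X → ℂ)
    (A B : ι → X → ℂ) :
    ∑ q, (d q - c * ∑ i, (A i q + B i q)) * ψ q =
      ∑ q, d q * ψ q - c * ∑ i, ((∑ q, A i q * ψ q) + ∑ q, B i q * ψ q) := by
  have h : ∀ q, (d q - c * ∑ i, (A i q + B i q)) * ψ q =
      d q * ψ q - c * ((∑ i, A i q * ψ q) + ∑ i, B i q * ψ q) := by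
    intro q
    rw [Finset.sum_add_distrib, ← Finset.sum_mul, ← Finset.sum_mul]
    ring
  simp_rw [h]
  rw [Finset.sum_sub_distrib, ← Finset.mul_sum, Finset.sum_add_distrib, Finset.sum_add_distrib,
    Finset.sum_comm, Finset.sum_comm (f := fun q i => B i q * ψ q)]

/-- **Row formula for `H = Γ₅ D_W(W, m₀, 1)` on the torus** (any side `L ≥ 1`, any field `ψ`): the on-site term
`(m₀ + 4) Σ_γ (γ₅)_{αγ} ψ(z, a, γ)` plus, for each direction `μ`, the forward hop through the link `W(z, μ)` to
`z + μ̂` (spin block `fwdHop μ = Γ₅ (−½)(1 − γ_μ)`) and the backward hop through `W(z − μ̂, μ)⁻¹` to `z − μ̂`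
(spin block `bwdHop μ = Γ₅ (−½)(1 + γ_μ)`).  The backward neighbour `q` with `z = q + μ̂` is unique; for `L ≤ 2`
it may coincide with `z + μ̂`, and the two hops are still two summands, as in `wilsonDirac`. -/
theorem ballSampling_mulVec_apply {L : ℕ} [NeZero L] (W : GaugeConfig 4 L SU3) (m₀ : ℝ)
    (ψ : QuarkIdx L → ℂ) (z : TorusSite 4 L) (a : Fin 3) (α : Fin 4) :
    (spinorLift gammaFive * wilsonDirac (fundamentalRep (Fin 3)) W m₀ 1).mulVec ψ (z, a, α) =
      ((m₀ + 4 : ℝ) : ℂ) * (∑ γ : Fin 4, gammaFive α γ * ψ (z, a, γ)) +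
        ∑ μ : Fin 4, ∑ b : Fin 3, ∑ β : Fin 4,
          (fwdHop μ α β * ((W (z, μ) : SU3) : Matrix (Fin 3) (Fin 3) ℂ) a b *
              ψ (Literature.MathematicalPhysics.QuantumFieldTheory.Site.shift z μ, b, β) +
            bwdHop μ α β *
                (((W (z - Pi.single μ 1, μ))⁻¹ : SU3) : Matrix (Fin 3) (Fin 3) ℂ) a b *
              ψ (z - Pi.single μ 1, b, β)) := by
  rw [spinorLift_gammaFive_eq_diagonal, ← mulVec_mulVec, mulVec_diagonal]
  dsimp only
  simp only [mulVec, dotProduct, wilsonDirac, of_apply]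
  rw [ballSampling_sum_aux]
  -- the diagonal term and the forward hops (`q.1 = z + μ̂`)
  simp only [ite_mul, zero_mul, Finset.sum_ite_eq, Finset.mem_univ, if_true,
    coareaWegner_sum_ite_fst_eq]
  -- the backward hops (`z = q.1 + μ̂ ↔ q.1 = z - μ̂`)
  simp only [ballSampling_eq_shift_iff z, coareaWegner_sum_ite_fst_eq]
  rw [ballSampling_gammaFive_row_sum]
  simp only [fundamentalRep_apply, Complex.ofReal_one, one_smul, mul_one]
  rw [mul_sub, sub_eq_add_neg]
  congr 1
  · ring
  · rw [← mul_assoc, ← neg_mul, Finset.mul_sum]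
    refine Finset.sum_congr rfl fun μ _ => ?_
    rw [mul_add, Finset.mul_sum, Finset.mul_sum, ← Finset.sum_add_distrib]
    refine Finset.sum_congr rfl fun b _ => ?_
    rw [Finset.mul_sum, Finset.mul_sum, ← Finset.sum_add_distrib]
    refine Finset.sum_congr rfl fun β _ => ?_
    rw [ballSampling_fwdHop_apply, ballSampling_bwdHop_apply]
    ring

/-! ### The sampling identity -/

/-- **Sampling identity, general zero-extended field.**  If `v : ℤ⁴ → Fin 3 → Fin 4 → ℂ` agrees with the
pull-back `y ↦ ψ(x + proj y)` at the site `y` (row `a`) and at its eight neighbours `y ± μ̂`, then the `ℤ⁴`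
Wilson–Dirac formula with the links read around `x` (the body of `ballApply`, for a general `v`) at `(y, a, α)`
IS `(Γ₅ D_W(W, m₀, 1) ψ)(x + proj y, a, α)` — on every torus `L ≥ 1` (for small `L` the sampled neighbours
`x + proj(y ± μ̂)` may coincide on the torus; the identity is insensitive to this). -/
theorem ballSampling_latticeApply_eq {L : ℕ} [NeZero L] (x : TorusSite 4 L) (W : GaugeConfig 4 L SU3)
    (m₀ : ℝ) (ψ : QuarkIdx L → ℂ) (v : (Fin 4 → ℤ) → Fin 3 → Fin 4 → ℂ) (y : Fin 4 → ℤ) (a : Fin 3)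
    (α : Fin 4) (h0 : ∀ γ, v y a γ = ψ (x + Torus.proj L y, a, γ))
    (hp : ∀ μ b β, v (y + Pi.single μ 1) b β = ψ (x + Torus.proj L (y + Pi.single μ 1), b, β))
    (hm : ∀ μ b β, v (y - Pi.single μ 1) b β = ψ (x + Torus.proj L (y - Pi.single μ 1), b, β)) :
    ((m₀ + 4 : ℝ) : ℂ) * (∑ γ : Fin 4, gammaFive α γ * v y a γ) +
        ∑ μ : Fin 4, ∑ b : Fin 3, ∑ β : Fin 4,
          (fwdHop μ α β * ((W (x + Torus.proj L y, μ) : SU3) : Matrix (Fin 3) (Fin 3) ℂ) a b *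
              v (y + Pi.single μ 1) b β +
            bwdHop μ α β *
                (((W (x + Torus.proj L (y - Pi.single μ 1), μ))⁻¹ : SU3) : Matrix (Fin 3) (Fin 3) ℂ) a b *
              v (y - Pi.single μ 1) b β) =
      (spinorLift gammaFive * wilsonDirac (fundamentalRep (Fin 3)) W m₀ 1).mulVec ψ
        (x + Torus.proj L y, a, α) := by
  rw [ballSampling_mulVec_apply]
  simp only [h0, hp, hm, ballSampling_proj_add_single, ballSampling_proj_sub_single]

/-- **Sampling identity with defect (linearity).**  For an ARBITRARY zero-extended field `v`, the `ℤ⁴` formula at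
`(y, a, α)` minus `(Γ₅ D_W ψ)(x + proj y, a, α)` is the same formula applied to the defect
`u ↦ v u − ψ(x + proj u)` at `y` and its neighbours — so a neighbour where `v` is cut off contributes exactly
minus its hop term (used at the faces of a cube). -/
theorem ballSampling_latticeApply_sub {L : ℕ} [NeZero L] (x : TorusSite 4 L) (W : GaugeConfig 4 L SU3)
    (m₀ : ℝ) (ψ : QuarkIdx L → ℂ) (v : (Fin 4 → ℤ) → Fin 3 → Fin 4 → ℂ) (y : Fin 4 → ℤ) (a : Fin 3)
    (α : Fin 4) :
    ((m₀ + 4 : ℝ) : ℂ) * (∑ γ : Fin 4, gammaFive α γ * v y a γ) +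
        ∑ μ : Fin 4, ∑ b : Fin 3, ∑ β : Fin 4,
          (fwdHop μ α β * ((W (x + Torus.proj L y, μ) : SU3) : Matrix (Fin 3) (Fin 3) ℂ) a b *
              v (y + Pi.single μ 1) b β +
            bwdHop μ α β *
                (((W (x + Torus.proj L (y - Pi.single μ 1), μ))⁻¹ : SU3) : Matrix (Fin 3) (Fin 3) ℂ) a b *
              v (y - Pi.single μ 1) b β) -
      (spinorLift gammaFive * wilsonDirac (fundamentalRep (Fin 3)) W m₀ 1).mulVec ψ
        (x + Torus.proj L y, a, α) =
    ((m₀ + 4 : ℝ) : ℂ) * (∑ γ : Fin 4, gammaFive α γ * (v y a γ - ψ (x + Torus.proj L y, a, γ))) +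
        ∑ μ : Fin 4, ∑ b : Fin 3, ∑ β : Fin 4,
          (fwdHop μ α β * ((W (x + Torus.proj L y, μ) : SU3) : Matrix (Fin 3) (Fin 3) ℂ) a b *
              (v (y + Pi.single μ 1) b β - ψ (x + Torus.proj L (y + Pi.single μ 1), b, β)) +
            bwdHop μ α β *
                (((W (x + Torus.proj L (y - Pi.single μ 1), μ))⁻¹ : SU3) : Matrix (Fin 3) (Fin 3) ℂ) a b *
              (v (y - Pi.single μ 1) b β - ψ (x + Torus.proj L (y - Pi.single μ 1), b, β))) := by
  rw [ballSampling_mulVec_apply]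
  simp only [ballSampling_proj_add_single, ballSampling_proj_sub_single, mul_sub, Finset.sum_sub_distrib,
    Finset.sum_add_distrib, Finset.mul_sum]
  ring

/-- **Sampling identity over the landed `latticeApply`** (links read around `x`): for a zero-extended field
agreeing with the pull-back of `ψ` at `y` and its eight neighbours,
`latticeApply m₀ w v y a α = (Γ₅ D_W(W, m₀, 1) ψ)(x + proj y, a, α)`, every torus `L ≥ 1`. -/
theorem ballSampling_latticeApply_read_eq {L : ℕ} [NeZero L] (x : TorusSite 4 L) (W : GaugeConfig 4 L SU3)
    (m₀ : ℝ) (ψ : QuarkIdx L → ℂ) (v : (Fin 4 → ℤ) → Fin 3 → Fin 4 → ℂ) (y : Fin 4 → ℤ) (a : Fin 3)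
    (α : Fin 4) (h0 : ∀ γ, v y a γ = ψ (x + Torus.proj L y, a, γ))
    (hp : ∀ μ b β, v (y + Pi.single μ 1) b β = ψ (x + Torus.proj L (y + Pi.single μ 1), b, β))
    (hm : ∀ μ b β, v (y - Pi.single μ 1) b β = ψ (x + Torus.proj L (y - Pi.single μ 1), b, β)) :
    latticeApply m₀ (fun l => W (x + Torus.proj L l.1, l.2)) v y a α =
      (spinorLift gammaFive * wilsonDirac (fundamentalRep (Fin 3)) W m₀ 1).mulVec ψ
        (x + Torus.proj L y, a, α) := by
  rw [latticeApply]
  exact ballSampling_latticeApply_eq x W m₀ ψ v y a α h0 hp hm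

/-- **Sampling identity with defect over the landed `latticeApply`**: for an arbitrary zero-extended field,
`latticeApply m₀ w v y a α − (Γ₅ D_W ψ)(x + proj y, a, α)` is the `ℤ⁴` formula applied to the defect
`u ↦ v u − ψ(x + proj u)`. -/
theorem ballSampling_latticeApply_read_sub {L : ℕ} [NeZero L] (x : TorusSite 4 L) (W : GaugeConfig 4 L SU3)
    (m₀ : ℝ) (ψ : QuarkIdx L → ℂ) (v : (Fin 4 → ℤ) → Fin 3 → Fin 4 → ℂ) (y : Fin 4 → ℤ) (a : Fin 3)
    (α : Fin 4) :
    latticeApply m₀ (fun l => W (x + Torus.proj L l.1, l.2)) v y a α -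
        (spinorLift gammaFive * wilsonDirac (fundamentalRep (Fin 3)) W m₀ 1).mulVec ψ
          (x + Torus.proj L y, a, α) =
      ((m₀ + 4 : ℝ) : ℂ) * (∑ γ : Fin 4, gammaFive α γ * (v y a γ - ψ (x + Torus.proj L y, a, γ))) +
        ∑ μ : Fin 4, ∑ b : Fin 3, ∑ β : Fin 4,
          (fwdHop μ α β * ((W (x + Torus.proj L y, μ) : SU3) : Matrix (Fin 3) (Fin 3) ℂ) a b *
              (v (y + Pi.single μ 1) b β - ψ (x + Torus.proj L (y + Pi.single μ 1), b, β)) +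
            bwdHop μ α β *
                (((W (x + Torus.proj L (y - Pi.single μ 1), μ))⁻¹ : SU3) : Matrix (Fin 3) (Fin 3) ℂ) a b *
              (v (y - Pi.single μ 1) b β - ψ (x + Torus.proj L (y - Pi.single μ 1), b, β))) := by
  rw [latticeApply]
  exact ballSampling_latticeApply_sub x W m₀ ψ v y a α

/-! ### The current identity -/

/-- **Current identity, general zero-extended field.**  If `v` agrees with the pull-back of `ψ` at `y` and at
`y + μ̂`, the `ℤ⁴` colour current through `(y, μ)` in direction `X_i` (the body of `ballCurrent`, general `v`,
links read around `x`) is the torus current of `ψ` through `(x + proj y, μ)`. -/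
theorem ballSampling_latticeCurrent_eq {L : ℕ} (x : TorusSite 4 L) (W : GaugeConfig 4 L SU3)
    (ψ : QuarkIdx L → ℂ) (v : (Fin 4 → ℤ) → Fin 3 → Fin 4 → ℂ) (y : Fin 4 → ℤ) (μ : Fin 4) (i : Fin 8)
    (h0 : ∀ a α, v y a α = ψ (x + Torus.proj L y, a, α))
    (hp : ∀ b β, v (y + Pi.single μ 1) b β = ψ (x + Torus.proj L (y + Pi.single μ 1), b, β)) :
    2 * (∑ a : Fin 3, ∑ b : Fin 3, ∑ α : Fin 4, ∑ β : Fin 4,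
        star (v y a α) * fwdHop μ α β *
          (((W (x + Torus.proj L y, μ) : SU3) : Matrix (Fin 3) (Fin 3) ℂ) * su3Basis i) a b *
          v (y + Pi.single μ 1) b β).re =
      2 * (∑ a : Fin 3, ∑ b : Fin 3, ∑ α : Fin 4, ∑ β : Fin 4,
        star (ψ (x + Torus.proj L y, a, α)) * fwdHop μ α β *
          (((W (x + Torus.proj L y, μ) : SU3) : Matrix (Fin 3) (Fin 3) ℂ) * su3Basis i) a b *
          ψ (Literature.MathematicalPhysics.QuantumFieldTheory.Site.shift (x + Torus.proj L y) μ, b, β)).re := by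
  simp only [h0, hp, ballSampling_proj_add_single]

/-- A cut-off forward neighbour kills the current: the current pairing of the site values `u` (at `y`) and
`u'` (at `y + μ̂`) through any colour matrix `M` vanishes if `u' = 0`. -/
theorem ballSampling_latticeCurrent_eq_zero (u u' : Fin 3 → Fin 4 → ℂ) (μ : Fin 4)
    (M : Matrix (Fin 3) (Fin 3) ℂ) (hp : ∀ b β, u' b β = 0) :
    2 * (∑ a : Fin 3, ∑ b : Fin 3, ∑ α : Fin 4, ∑ β : Fin 4,
        star (u a α) * fwdHop μ α β * M a b * u' b β).re = 0 := by
  simp only [hp, mul_zero, Finset.sum_const_zero, Complex.zero_re]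

/-- A cut-off base site kills the current: the same pairing vanishes if `u = 0`. -/
theorem ballSampling_latticeCurrent_eq_zero_of_base (u u' : Fin 3 → Fin 4 → ℂ) (μ : Fin 4)
    (M : Matrix (Fin 3) (Fin 3) ℂ) (h0 : ∀ a α, u a α = 0) :
    2 * (∑ a : Fin 3, ∑ b : Fin 3, ∑ α : Fin 4, ∑ β : Fin 4,
        star (u a α) * fwdHop μ α β * M a b * u' b β).re = 0 := by
  simp only [h0, star_zero, zero_mul, Finset.sum_const_zero, mul_zero, Complex.zero_re]

/-- **Term-by-term current domination for a cut-off pull-back.**  If at every site of `ℤ⁴` the zero-extended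
field `v` is either the pull-back `ψ(x + proj ·)` or `0` (e.g. `ballVal` / a port-domain extension of the
restriction of `ψ`), then for EVERY link `(y, μ)` and direction `X_i` the `ℤ⁴` current of `v` is dominated in
absolute value by the torus current of `ψ` through `(x + proj y, μ)`: they are equal when `v` is the pull-back
at `y` and `y + μ̂`, and the former is `0` otherwise. -/
theorem ballSampling_abs_latticeCurrent_le {L : ℕ} (x : TorusSite 4 L) (W : GaugeConfig 4 L SU3)
    (ψ : QuarkIdx L → ℂ) (v : (Fin 4 → ℤ) → Fin 3 → Fin 4 → ℂ)
    (hv : ∀ u : Fin 4 → ℤ, (∀ a α, v u a α = ψ (x + Torus.proj L u, a, α)) ∨ ∀ a α, v u a α = 0)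
    (y : Fin 4 → ℤ) (μ : Fin 4) (i : Fin 8) :
    |2 * (∑ a : Fin 3, ∑ b : Fin 3, ∑ α : Fin 4, ∑ β : Fin 4,
        star (v y a α) * fwdHop μ α β *
          (((W (x + Torus.proj L y, μ) : SU3) : Matrix (Fin 3) (Fin 3) ℂ) * su3Basis i) a b *
          v (y + Pi.single μ 1) b β).re| ≤
      |2 * (∑ a : Fin 3, ∑ b : Fin 3, ∑ α : Fin 4, ∑ β : Fin 4,
        star (ψ (x + Torus.proj L y, a, α)) * fwdHop μ α β *
          (((W (x + Torus.proj L y, μ) : SU3) : Matrix (Fin 3) (Fin 3) ℂ) * su3Basis i) a b *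
          ψ (Literature.MathematicalPhysics.QuantumFieldTheory.Site.shift (x + Torus.proj L y) μ, b, β)).re| := by
  rcases hv y with h0 | h0
  · rcases hv (y + Pi.single μ 1) with hp | hp
    · rw [ballSampling_latticeCurrent_eq x W ψ v y μ i h0 hp]
    · rw [ballSampling_latticeCurrent_eq_zero (v y) (v (y + Pi.single μ 1)) μ _ hp, abs_zero]
      exact abs_nonneg _
  · rw [ballSampling_latticeCurrent_eq_zero_of_base (v y) (v (y + Pi.single μ 1)) μ _ h0, abs_zero]
    exact abs_nonneg _

/-- **Current identity over the landed `latticeCurrent`** (links read around `x`). -/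
theorem ballSampling_latticeCurrent_read_eq {L : ℕ} (x : TorusSite 4 L) (W : GaugeConfig 4 L SU3)
    (ψ : QuarkIdx L → ℂ) (v : (Fin 4 → ℤ) → Fin 3 → Fin 4 → ℂ) (y : Fin 4 → ℤ) (μ : Fin 4) (i : Fin 8)
    (h0 : ∀ a α, v y a α = ψ (x + Torus.proj L y, a, α))
    (hp : ∀ b β, v (y + Pi.single μ 1) b β = ψ (x + Torus.proj L (y + Pi.single μ 1), b, β)) :
    latticeCurrent (fun l => W (x + Torus.proj L l.1, l.2)) v y μ i =
      2 * (∑ a : Fin 3, ∑ b : Fin 3, ∑ α : Fin 4, ∑ β : Fin 4,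
        star (ψ (x + Torus.proj L y, a, α)) * fwdHop μ α β *
          (((W (x + Torus.proj L y, μ) : SU3) : Matrix (Fin 3) (Fin 3) ℂ) * su3Basis i) a b *
          ψ (Literature.MathematicalPhysics.QuantumFieldTheory.Site.shift (x + Torus.proj L y) μ, b, β)).re := by
  rw [latticeCurrent]
  exact ballSampling_latticeCurrent_eq x W ψ v y μ i h0 hp

/-- **Link-by-link current domination over the landed `latticeCurrent`** for a cut-off pull-back. -/
theorem ballSampling_abs_latticeCurrent_read_le {L : ℕ} (x : TorusSite 4 L) (W : GaugeConfig 4 L SU3)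
    (ψ : QuarkIdx L → ℂ) (v : (Fin 4 → ℤ) → Fin 3 → Fin 4 → ℂ)
    (hv : ∀ u : Fin 4 → ℤ, (∀ a α, v u a α = ψ (x + Torus.proj L u, a, α)) ∨ ∀ a α, v u a α = 0)
    (y : Fin 4 → ℤ) (μ : Fin 4) (i : Fin 8) :
    |latticeCurrent (fun l => W (x + Torus.proj L l.1, l.2)) v y μ i| ≤
      |2 * (∑ a : Fin 3, ∑ b : Fin 3, ∑ α : Fin 4, ∑ β : Fin 4,
        star (ψ (x + Torus.proj L y, a, α)) * fwdHop μ α β *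
          (((W (x + Torus.proj L y, μ) : SU3) : Matrix (Fin 3) (Fin 3) ℂ) * su3Basis i) a b *
          ψ (Literature.MathematicalPhysics.QuantumFieldTheory.Site.shift (x + Torus.proj L y) μ, b, β)).re| := by
  rw [latticeCurrent]
  exact ballSampling_abs_latticeCurrent_le x W ψ v hv y μ i

/-- **Cube current domination in the registered notation.**  For a cut-off pull-back `v` as above and the
glued configuration `glue_{x,R}(U, V)` read around `x`, the total absolute `ℤ⁴` current
`Σ_{y ∈ box R, μ, i} |latticeCurrent w v y μ i|` through the links based in the cube `box 4 R` (for `v = portVal φ`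
this is `portCurrentSum R w φ` unfolded) is at most the right-hand side of the registered `stub_currentRigidity`,
VERBATIM (the summands agree up to unfolding `fwdHop μ = γ₅ · (−½)(1 − γ_μ)`, `su3Basis = ![X_0, …, X_7]` and
β-reducing the glue). -/
theorem ballSampling_cubeCurrent_le_verbatim (R : ℕ) {L : ℕ} (x : TorusSite 4 L) (U V : GaugeConfig 4 L SU3)
    (ψ : QuarkIdx L → ℂ) (v : (Fin 4 → ℤ) → Fin 3 → Fin 4 → ℂ)
    (hv : ∀ u : Fin 4 → ℤ, (∀ a α, v u a α = ψ (x + Torus.proj L u, a, α)) ∨ ∀ a α, v u a α = 0) :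
    ∑ y ∈ box 4 R, ∑ μ : Fin 4, ∑ i : Fin 8,
        |latticeCurrent
            (fun l => (fun e : Edge 4 L => if (∃ y ∈ box 4 R, e.1 = x + Torus.proj L y) then V e else U e)
              (x + Torus.proj L l.1, l.2)) v y μ i| ≤
      ∑ y ∈ box 4 R, ∑ μ : Fin 4, ∑ i : Fin 8,
              |2 * (∑ a : Fin 3, ∑ b : Fin 3, ∑ α : Fin 4, ∑ β : Fin 4,
                  star (ψ (x + Torus.proj L y, a, α)) *
                    (gammaFive * ((-(1 / 2 : ℂ)) • ((1 : Matrix (Fin 4) (Fin 4) ℂ) - euclideanGamma μ))) α β *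
                    ((((fun e : Edge 4 L => if (∃ y ∈ box 4 R, e.1 = x + Torus.proj L y) then V e else U e)
                          (x + Torus.proj L y, μ) : SU3) : Matrix (Fin 3) (Fin 3) ℂ) *
                        (![!![0, 1, 0; -1, 0, 0; 0, 0, 0], !![0, 0, 1; 0, 0, 0; -1, 0, 0],
                           !![0, 0, 0; 0, 0, 1; 0, -1, 0], !![0, Complex.I, 0; Complex.I, 0, 0; 0, 0, 0],
                           !![0, 0, Complex.I; 0, 0, 0; Complex.I, 0, 0],
                           !![0, 0, 0; 0, 0, Complex.I; 0, Complex.I, 0],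
                           !![Complex.I, 0, 0; 0, -Complex.I, 0; 0, 0, 0],
                           !![0, 0, 0; 0, Complex.I, 0; 0, 0, -Complex.I]] i : Matrix (Fin 3) (Fin 3) ℂ)) a b *
                    ψ (Literature.MathematicalPhysics.QuantumFieldTheory.Site.shift (x + Torus.proj L y) μ,
                      b, β)).re| := by
  refine Finset.sum_le_sum fun y _ => Finset.sum_le_sum fun μ _ => Finset.sum_le_sum fun i _ => ?_
  -- the two sides agree up to unfolding `fwdHop`, `su3Basis` and β-reduction of the glue
  exact ballSampling_abs_latticeCurrent_read_le x
    (fun e : Edge 4 L => if (∃ y ∈ box 4 R, e.1 = x + Torus.proj L y) then V e else U e) ψ v hv y μ i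

/-- **The current in the registered notation.**  The torus current written with `fwdHop` / `su3Basis` is, by
`rfl`, the `(·, μ, i)` summand of the right-hand side of `stub_currentRigidity` (there with `z = x + proj y` and
`W` the glued configuration). -/
theorem ballSampling_current_verbatim {L : ℕ} (W : GaugeConfig 4 L SU3) (ψ : QuarkIdx L → ℂ)
    (z : TorusSite 4 L) (μ : Fin 4) (i : Fin 8) :
    2 * (∑ a : Fin 3, ∑ b : Fin 3, ∑ α : Fin 4, ∑ β : Fin 4,
        star (ψ (z, a, α)) * fwdHop μ α β *
          (((W (z, μ) : SU3) : Matrix (Fin 3) (Fin 3) ℂ) * su3Basis i) a b *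
          ψ (Literature.MathematicalPhysics.QuantumFieldTheory.Site.shift z μ, b, β)).re =
      2 * (∑ a : Fin 3, ∑ b : Fin 3, ∑ α : Fin 4, ∑ β : Fin 4,
        star (ψ (z, a, α)) *
          (gammaFive * ((-(1 / 2 : ℂ)) • ((1 : Matrix (Fin 4) (Fin 4) ℂ) - euclideanGamma μ))) α β *
          (((W (z, μ) : SU3) : Matrix (Fin 3) (Fin 3) ℂ) *
              (![!![0, 1, 0; -1, 0, 0; 0, 0, 0], !![0, 0, 1; 0, 0, 0; -1, 0, 0],
                 !![0, 0, 0; 0, 0, 1; 0, -1, 0], !![0, Complex.I, 0; Complex.I, 0, 0; 0, 0, 0],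
                 !![0, 0, Complex.I; 0, 0, 0; Complex.I, 0, 0],
                 !![0, 0, 0; 0, 0, Complex.I; 0, Complex.I, 0],
                 !![Complex.I, 0, 0; 0, -Complex.I, 0; 0, 0, 0],
                 !![0, 0, 0; 0, Complex.I, 0; 0, 0, -Complex.I]] i : Matrix (Fin 3) (Fin 3) ℂ)) a b *
          ψ (Literature.MathematicalPhysics.QuantumFieldTheory.Site.shift z μ, b, β)).re :=
  rfl

end Summit.QuantumFields.QCD.Cruxes.WegnerEstimate.ResolventCell

end
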